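import Mathlib
import HarnessLib
import Literature.NumberTheory.Transcendental.KZCalculusProofs
import Summits.KontsevichZagierPeriods.KontsevichZagierPeriods.Theorems.ResidualBeyondGenusZero.Negative.LoadBearing
import Summits.KontsevichZagierPeriods.KontsevichZagierPeriods.Theorems.LinRedNormalFormResidualBeyondGenusZeroDimOnePieces

/-!
# Route LinRedNormalForm, item `ResidualBeyondGenusZero` (stmt-KontsevichZagierPeriods-3917): the dimension ladder

`ResidualBeyondGenusZero` (RES) — every vanishing formal combination is congruent modulo
`KZ.relations` to a `ℤ`-combination of genus-zero representations, `ker eval ≤ relations ⊔ ⟨GZ⟩` — is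
the DECLARED RESIDUAL of route LinRedNormalForm (summit-strength, planner-held). Its only registered
line (`Cruxes/ResidualBeyondGenusZero/Lines/dim_one_splice.lean`, crux-strategist BC2 redirect) peels the
one-dimensional sector and leaves the declared stub

  `stub_residualBeyondDimOne : ∀ c, eval c = 0 → ∃ c₁ ∈ closure (gzSet ∪ D₁), c - c₁ ∈ relations`

("residual beyond `GZ ∪ D₁`"), whose own plan is "the next rung of the dimension ladder". This file
makes the WHOLE ladder a theorem. Write `D_d := Set.range (KZ.of : IntegralRep d → FormalRep)` for the
classes of the `d`-dimensional representations and, for `d : ℕ`,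

* `Residual d  :≡ ∀ c, eval c = 0 → ∃ c' ∈ closure (gzSet ∪ D_d), c - c' ∈ relations`
  (residual beyond genus zero and dimension `d`; `Residual 1` is the stub verbatim),
* `RelKer d    :≡ ∀ m ∈ closure (gzSet ∪ D_{d+1}), eval m = 0 → ∃ m' ∈ closure (gzSet ∪ D_d), m - m' ∈ relations`
  (the RUNG `d + 1 → d`: a vanishing combination of genus-zero and `(d+1)`-dimensional
  representations reduces, modulo moves, to genus-zero and `d`-dimensional ones),
* `Bottom      :≡ ∀ m ∈ closure (gzSet ∪ D₁), eval m = 0 → ∃ g ∈ closure gzSet, m - g ∈ relations`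
  (the bottom rung `1 → genus zero`).

Main statements (all sorry-free; soundness of the calculus + subgroup algebra + ONE geometric input,
the slab move `KZ.IntegralRep.exists_equivalent_of_le`: every representation is a Newton–Leibniz
move away from one in each higher dimension):

* `exists_forall_mem_relations_sup_closure_range` — EXHAUSTION: every formal combination is
  congruent modulo relations to a `ℤ`-combination of `N`-dimensional representations, for every
  large `N` (finite support in the free abelian group + slabs);
* `residual_iff_ladder` — for every `d`, `Residual d ↔ ∀ d' ≥ d, RelKer d'`; in particular
  (`residualBeyondDimOne_iff_ladder`) **the declared stub `stub_residualBeyondDimOne` is EXACTLY the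
  conjunction of the rungs `RelKer d`, `d ≥ 1`** — promoting the stub is filing the rungs, each a
  bona fide sector normal-form statement (dimension `d + 1 →` dimension `d` modulo genus zero:
  `d = 1` is the home of Legendre's relation, beta/`Γ` products, `ζ(2)` as an area, Catalan-type
  2-periods);
* `residual_succ_iff` — peeling one rung: `Residual d ↔ RelKer d ∧ Residual (d + 1)`;
* `residualBeyondGenusZero_iff_bottom_and_ladder` — **the crux is, losslessly, the bottom rung plus
  the ladder**: `RES ↔ Bottom ∧ ∀ d ≥ 1, RelKer d`;
* `bottom_of_kernel_of_separation` / `dimOneSeparation_of_bottom` — the bottom rung from the two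
  dimension-one pieces of the split (`DimOneKernelInKZ`, `DimOneSeparation`), and conversely the
  bottom rung gives the separation piece outright;
* `residualBeyondGenusZero_of_pieces_and_ladder` — the line's composition with stub 5 unfolded into
  rungs: `DimOneKernelInKZ → DimOneSeparation → (∀ d ≥ 1, RelKer d) → RES`;
* `relKer_of_residualBeyondGenusZero`, `residualDim_of_residualBeyondGenusZero` — every rung and
  every `Residual d` is implied by the crux (hence by the summit): nothing here is stronger than RES.

References: M. Kontsevich, D. Zagier, *Periods* (2001), §1.2 (rules (1)–(3), Conjecture 1);
A. Huber, S. Müller-Stach, *Periods and Nori Motives* (2017), Conj. 13.2.1 (kernel form).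
-/

noncomputable section

namespace Summit.KontsevichZagierPeriods.ResidualBeyondGenusZero

open Literature.NumberTheory.Transcendental
open Summit.KontsevichZagierPeriods.KontsevichZagierPeriods.Theses.LinRedNormalForm (ResidualBeyondGenusZero)
open Summit.KontsevichZagierPeriods.ResidualBeyondGenusZero.Negative (gzSet gzSet_eq residual_iff)

/-! ## §1 Raising the dimension inside the formal group (slabs) -/

/-- **One generator, raised.** For `k ≤ N`, the class of a `k`-dimensional representation lies in
`relations ⊔ closure D_N`: by `KZ.IntegralRep.exists_equivalent_of_le` (iterated slab
`σ × [0,1]`, one Newton–Leibniz move per extra dimension) it is equivalent to an `N`-dimensional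
representation. [Kontsevich–Zagier 2001, §1.2, rule (3)] -/
theorem of_mem_relations_sup_closure_range {k N : ℕ} (h : k ≤ N) (r : KZ.IntegralRep k) :
    KZ.of r ∈ KZ.relations ⊔ AddSubgroup.closure (Set.range fun r : KZ.IntegralRep N => KZ.of r) := by
  obtain ⟨R, hR⟩ := r.exists_equivalent_of_le h
  rw [AddSubgroup.mem_sup]
  exact ⟨KZ.of r - KZ.of R, hR, KZ.of R, AddSubgroup.subset_closure ⟨R, rfl⟩, by abel⟩

/-- **Exhaustion by dimension.** Every formal combination `c` is congruent modulo `KZ.relations` to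
a `ℤ`-combination of `N`-dimensional representations for EVERY `N` beyond some `N₀` (the largest
dimension occurring in `c`): induction over the free abelian group, raising each generator by
`of_mem_relations_sup_closure_range`. [Kontsevich–Zagier 2001, §1.2] -/
theorem exists_forall_mem_relations_sup_closure_range (c : KZ.FormalRep) :
    ∃ N₀ : ℕ, ∀ N, N₀ ≤ N → c ∈ KZ.relations ⊔ AddSubgroup.closure (Set.range fun r : KZ.IntegralRep N => KZ.of r) := by
  induction c using FreeAbelianGroup.induction_on with
  | zero => exact ⟨0, fun N _ => zero_mem _⟩
  | of x =>
    obtain ⟨k, r⟩ := x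
    exact ⟨k, fun N hN => of_mem_relations_sup_closure_range hN r⟩
  | neg x hx =>
    obtain ⟨N₀, hN₀⟩ := hx
    exact ⟨N₀, fun N hN => neg_mem (hN₀ N hN)⟩
  | add x y hx hy =>
    obtain ⟨N₁, hN₁⟩ := hx
    obtain ⟨N₂, hN₂⟩ := hy
    exact ⟨max N₁ N₂, fun N hN =>
      add_mem (hN₁ N ((le_max_left _ _).trans hN)) (hN₂ N ((le_max_right _ _).trans hN))⟩

/-- **Monotonicity of the joint sectors modulo moves.** For `d ≤ d'`,
`closure (gzSet ∪ D_d) ≤ relations ⊔ closure (gzSet ∪ D_{d'})` (genus-zero generators stay,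
`d`-dimensional ones are raised). [Kontsevich–Zagier 2001, §1.2] -/
theorem closure_gzSet_union_range_le_sup {d d' : ℕ} (h : d ≤ d') :
    AddSubgroup.closure (gzSet ∪ (Set.range fun r : KZ.IntegralRep d => KZ.of r)) ≤ KZ.relations ⊔ AddSubgroup.closure (gzSet ∪ (Set.range fun r : KZ.IntegralRep d' => KZ.of r)) := by
  rw [AddSubgroup.closure_le]
  rintro x (hx | ⟨r, rfl⟩)
  · exact AddSubgroup.mem_sup_right (AddSubgroup.subset_closure (Or.inl hx))
  · exact (sup_le_sup_left (AddSubgroup.closure_mono Set.subset_union_right) KZ.relations)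
      (of_mem_relations_sup_closure_range h r)

/-! ## §2 The ladder: `Residual d ↔ ∀ d' ≥ d, RelKer d'` -/

/-- **Descent along finitely many rungs.** If the rungs `RelKer d'` hold for all `d' ≥ d`, then a
vanishing `c ∈ relations ⊔ closure (gzSet ∪ D_{d+j})` is congruent modulo relations to an element
of `closure (gzSet ∪ D_d)` (induction on `j`; the intermediate elements vanish by soundness
`KZ.relations_le_ker_eval_holds`). [folklore] -/
theorem residual_descend_iterate (d : ℕ)
    (hL : ∀ d', d ≤ d' → ∀ m ∈ AddSubgroup.closure (gzSet ∪ (Set.range fun r : KZ.IntegralRep (d' + 1) => KZ.of r)), KZ.eval m = 0 →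
      ∃ m' ∈ AddSubgroup.closure (gzSet ∪ (Set.range fun r : KZ.IntegralRep d' => KZ.of r)), m - m' ∈ KZ.relations) :
    ∀ (j : ℕ) (c : KZ.FormalRep), KZ.eval c = 0 →
      c ∈ KZ.relations ⊔ AddSubgroup.closure (gzSet ∪ (Set.range fun r : KZ.IntegralRep (d + j) => KZ.of r)) →
      ∃ c' ∈ AddSubgroup.closure (gzSet ∪ (Set.range fun r : KZ.IntegralRep d => KZ.of r)), c - c' ∈ KZ.relations := by
  intro j
  induction j with
  | zero =>
    intro c _ hmem
    obtain ⟨ρ, hρ, s, hs, rfl⟩ := AddSubgroup.mem_sup.1 hmem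
    exact ⟨s, hs, by simpa using hρ⟩
  | succ j ih =>
    intro c hc hmem
    obtain ⟨ρ, hρ, s, hs, rfl⟩ := AddSubgroup.mem_sup.1 hmem
    have hρ0 : KZ.eval ρ = 0 := (AddMonoidHom.mem_ker).1 (KZ.relations_le_ker_eval_holds hρ)
    have hs0 : KZ.eval s = 0 := by
      rw [map_add, hρ0, zero_add] at hc
      exact hc
    obtain ⟨s', hs', hss'⟩ := hL (d + j) (Nat.le_add_right d j) s hs hs0
    refine ih (ρ + s) hc (AddSubgroup.mem_sup.2 ⟨ρ + (s - s'), add_mem hρ hss', s', hs', ?_⟩)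
    abel

/-- **The ladder gives the residual** (`⇐` of `residual_iff_ladder`): if every rung `RelKer d'`,
`d' ≥ d`, holds, then every vanishing formal combination is congruent modulo relations to an
element of `closure (gzSet ∪ D_d)` — exhaust `c` by some dimension `d + N`
(`exists_forall_mem_relations_sup_closure_range`) and descend (`residual_descend_iterate`). [folklore] -/
theorem residual_of_ladder (d : ℕ)
    (hL : ∀ d', d ≤ d' → ∀ m ∈ AddSubgroup.closure (gzSet ∪ (Set.range fun r : KZ.IntegralRep (d' + 1) => KZ.of r)), KZ.eval m = 0 →
      ∃ m' ∈ AddSubgroup.closure (gzSet ∪ (Set.range fun r : KZ.IntegralRep d' => KZ.of r)), m - m' ∈ KZ.relations) :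
    ∀ c : KZ.FormalRep, KZ.eval c = 0 →
      ∃ c' ∈ AddSubgroup.closure (gzSet ∪ (Set.range fun r : KZ.IntegralRep d => KZ.of r)), c - c' ∈ KZ.relations := by
  intro c hc
  obtain ⟨N, hN⟩ := exists_forall_mem_relations_sup_closure_range c
  refine residual_descend_iterate d hL N c hc ?_
  exact (sup_le_sup_left (AddSubgroup.closure_mono Set.subset_union_right) KZ.relations)
    (hN (d + N) (Nat.le_add_left N d))

/-- **The residual gives the ladder** (`⇒` of `residual_iff_ladder`): if every vanishing formal
combination reduces modulo relations to `closure (gzSet ∪ D_d)`, then for every `d' ≥ d` every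
vanishing combination (in particular every vanishing element of `closure (gzSet ∪ D_{d'+1})`) reduces
to `closure (gzSet ∪ D_{d'})`, raising the `d`-dimensional part by slabs
(`closure_gzSet_union_range_le_sup`). [folklore] -/
theorem ladder_of_residual (d : ℕ)
    (hR : ∀ c : KZ.FormalRep, KZ.eval c = 0 →
      ∃ c' ∈ AddSubgroup.closure (gzSet ∪ (Set.range fun r : KZ.IntegralRep d => KZ.of r)), c - c' ∈ KZ.relations) :
    ∀ d', d ≤ d' → ∀ m ∈ AddSubgroup.closure (gzSet ∪ (Set.range fun r : KZ.IntegralRep (d' + 1) => KZ.of r)), KZ.eval m = 0 →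
      ∃ m' ∈ AddSubgroup.closure (gzSet ∪ (Set.range fun r : KZ.IntegralRep d' => KZ.of r)), m - m' ∈ KZ.relations := by
  intro d' hdd' m _ hm0
  obtain ⟨c', hc', hmc'⟩ := hR m hm0
  obtain ⟨ρ, hρ, s, hs, hρs⟩ := AddSubgroup.mem_sup.1 (closure_gzSet_union_range_le_sup hdd' hc')
  refine ⟨s, hs, ?_⟩
  have e : m - s = (m - c') + ρ := by rw [← hρs]; abel
  rw [e]
  exact add_mem hmc' hρ

/-- **THE LADDER THEOREM.** For every `d`, the residual beyond genus zero and dimension `d` is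
EQUIVALENT to the conjunction of the rungs above it:
`(∀ c, eval c = 0 → ∃ c' ∈ closure (gzSet ∪ D_d), c - c' ∈ relations) ↔
 ∀ d' ≥ d, ∀ m ∈ closure (gzSet ∪ D_{d'+1}), eval m = 0 → ∃ m' ∈ closure (gzSet ∪ D_{d'}), m - m' ∈ relations`.
[folklore] -/
theorem residual_iff_ladder (d : ℕ) :
    (∀ c : KZ.FormalRep, KZ.eval c = 0 →
      ∃ c' ∈ AddSubgroup.closure (gzSet ∪ (Set.range fun r : KZ.IntegralRep d => KZ.of r)), c - c' ∈ KZ.relations) ↔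
    ∀ d', d ≤ d' → ∀ m ∈ AddSubgroup.closure (gzSet ∪ (Set.range fun r : KZ.IntegralRep (d' + 1) => KZ.of r)), KZ.eval m = 0 →
      ∃ m' ∈ AddSubgroup.closure (gzSet ∪ (Set.range fun r : KZ.IntegralRep d' => KZ.of r)), m - m' ∈ KZ.relations :=
  ⟨ladder_of_residual d, residual_of_ladder d⟩

/-- **Monotonicity of the residuals.** For `d ≤ d'`, the residual beyond dimension `d` gives the
residual beyond dimension `d'` (raise by slabs). [folklore] -/
theorem residualDim_mono {d d' : ℕ} (h : d ≤ d')
    (hR : ∀ c : KZ.FormalRep, KZ.eval c = 0 →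
      ∃ c' ∈ AddSubgroup.closure (gzSet ∪ (Set.range fun r : KZ.IntegralRep d => KZ.of r)), c - c' ∈ KZ.relations) :
    ∀ c : KZ.FormalRep, KZ.eval c = 0 →
      ∃ c' ∈ AddSubgroup.closure (gzSet ∪ (Set.range fun r : KZ.IntegralRep d' => KZ.of r)), c - c' ∈ KZ.relations :=
  residual_of_ladder d' fun e hde => ladder_of_residual d hR e (h.trans hde)

/-- **Peeling one rung.** `Residual d ↔ RelKer d ∧ Residual (d + 1)`: the residual beyond dimension
`d` is the rung `d + 1 → d` together with the residual beyond dimension `d + 1`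
(`⇐` is `residual_descend`; `⇒` by the ladder theorem and monotonicity). [folklore] -/
theorem residual_succ_iff (d : ℕ) :
    (∀ c : KZ.FormalRep, KZ.eval c = 0 →
      ∃ c' ∈ AddSubgroup.closure (gzSet ∪ (Set.range fun r : KZ.IntegralRep d => KZ.of r)), c - c' ∈ KZ.relations) ↔
    (∀ m ∈ AddSubgroup.closure (gzSet ∪ (Set.range fun r : KZ.IntegralRep (d + 1) => KZ.of r)), KZ.eval m = 0 →
      ∃ m' ∈ AddSubgroup.closure (gzSet ∪ (Set.range fun r : KZ.IntegralRep d => KZ.of r)), m - m' ∈ KZ.relations) ∧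
    (∀ c : KZ.FormalRep, KZ.eval c = 0 →
      ∃ c' ∈ AddSubgroup.closure (gzSet ∪ (Set.range fun r : KZ.IntegralRep (d + 1) => KZ.of r)), c - c' ∈ KZ.relations) := by
  constructor
  · intro hR
    exact ⟨ladder_of_residual d hR d le_rfl, residualDim_mono (Nat.le_succ d) hR⟩
  · rintro ⟨hRel, hRes⟩
    exact residual_descend KZ.eval KZ.relations_le_ker_eval_holds hRel hRes

/-! ## §3 The declared stub of the line and the crux, as rungs -/

/-- **`stub_residualBeyondDimOne` IS the ladder from dimension one.** The declared stub 5 of line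
`dim-one-splice` (= child `ResidualBeyondDimOne` of `SPLIT.md`, over the named generator set
`gzSet`), verbatim, is equivalent to the conjunction of the rungs `RelKer d`, `d ≥ 1`: a vanishing
`ℤ`-combination of genus-zero and `(d+1)`-dimensional representations reduces, modulo moves, to
genus-zero and `d`-dimensional ones. [folklore] -/
theorem residualBeyondDimOne_iff_ladder :
    (∀ c : KZ.FormalRep, KZ.eval c = 0 →
      ∃ c₁ ∈ AddSubgroup.closure (gzSet ∪ (Set.range fun r : KZ.IntegralRep 1 => KZ.of r)), c - c₁ ∈ KZ.relations) ↔
    ∀ d, 1 ≤ d → ∀ m ∈ AddSubgroup.closure (gzSet ∪ (Set.range fun r : KZ.IntegralRep (d + 1) => KZ.of r)), KZ.eval m = 0 →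
      ∃ m' ∈ AddSubgroup.closure (gzSet ∪ (Set.range fun r : KZ.IntegralRep d => KZ.of r)), m - m' ∈ KZ.relations :=
  residual_iff_ladder 1

/-- **The crux is the bottom rung plus the residual beyond dimension one** (lossless):
`RES ↔ Bottom ∧ Residual 1`, where `Bottom` says that a vanishing element of `closure (gzSet ∪ D₁)`
is congruent modulo relations to a genus-zero combination. `⇒`: both are weakenings of RES;
`⇐`: `residual_descend`. [folklore] -/
theorem residualBeyondGenusZero_iff_bottom_and_residualDimOne :
    ResidualBeyondGenusZero ↔
      (∀ m ∈ AddSubgroup.closure (gzSet ∪ (Set.range fun r : KZ.IntegralRep 1 => KZ.of r)), KZ.eval m = 0 →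
        ∃ g ∈ AddSubgroup.closure gzSet, m - g ∈ KZ.relations) ∧
      (∀ c : KZ.FormalRep, KZ.eval c = 0 →
        ∃ c₁ ∈ AddSubgroup.closure (gzSet ∪ (Set.range fun r : KZ.IntegralRep 1 => KZ.of r)), c - c₁ ∈ KZ.relations) := by
  rw [residual_iff]
  constructor
  · intro h
    refine ⟨fun m _ hm0 => h m hm0, fun c hc => ?_⟩
    obtain ⟨c₀, hc₀, hcc₀⟩ := h c hc
    exact ⟨c₀, AddSubgroup.closure_mono Set.subset_union_left hc₀, hcc₀⟩
  · rintro ⟨hB, hR⟩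
    exact residual_descend KZ.eval KZ.relations_le_ker_eval_holds hB hR

/-- **THE CRUX AS A LADDER** (lossless): `ResidualBeyondGenusZero` holds if and only if the bottom
rung (`closure (gzSet ∪ D₁) →` genus zero on vanishing elements) and every rung `RelKer d`, `d ≥ 1`
(`closure (gzSet ∪ D_{d+1}) → closure (gzSet ∪ D_d)` on vanishing elements) hold. Every conjunct is
a sector statement of Conjecture 1 "one dimension at a time, modulo genus zero"; none is a
truncation of RES in the sense refuted-as-useless by the Disproof (§6), and each is RES-implied
(`relKer_of_residualBeyondGenusZero`). [folklore] -/
theorem residualBeyondGenusZero_iff_bottom_and_ladder :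
    ResidualBeyondGenusZero ↔
      (∀ m ∈ AddSubgroup.closure (gzSet ∪ (Set.range fun r : KZ.IntegralRep 1 => KZ.of r)), KZ.eval m = 0 →
        ∃ g ∈ AddSubgroup.closure gzSet, m - g ∈ KZ.relations) ∧
      (∀ d, 1 ≤ d → ∀ m ∈ AddSubgroup.closure (gzSet ∪ (Set.range fun r : KZ.IntegralRep (d + 1) => KZ.of r)), KZ.eval m = 0 →
        ∃ m' ∈ AddSubgroup.closure (gzSet ∪ (Set.range fun r : KZ.IntegralRep d => KZ.of r)), m - m' ∈ KZ.relations) := by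
  rw [residualBeyondGenusZero_iff_bottom_and_residualDimOne, residualBeyondDimOne_iff_ladder]

/-- **Every rung is implied by the crux** (so the ladder loses nothing and no rung is stronger than
RES, which the summit implies): RES gives `RelKer d` for every `d` (including `d = 0`). [folklore] -/
theorem relKer_of_residualBeyondGenusZero (hRES : ResidualBeyondGenusZero) (d : ℕ) :
    ∀ m ∈ AddSubgroup.closure (gzSet ∪ (Set.range fun r : KZ.IntegralRep (d + 1) => KZ.of r)), KZ.eval m = 0 →
      ∃ m' ∈ AddSubgroup.closure (gzSet ∪ (Set.range fun r : KZ.IntegralRep d => KZ.of r)), m - m' ∈ KZ.relations := by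
  intro m _ hm0
  obtain ⟨c₀, hc₀, hmc₀⟩ := residual_iff.1 hRES m hm0
  exact ⟨c₀, AddSubgroup.closure_mono Set.subset_union_left hc₀, hmc₀⟩

/-- **Every residual beyond a dimension is implied by the crux**: RES gives `Residual d` for every
`d`. [folklore] -/
theorem residualDim_of_residualBeyondGenusZero (hRES : ResidualBeyondGenusZero) (d : ℕ) :
    ∀ c : KZ.FormalRep, KZ.eval c = 0 →
      ∃ c' ∈ AddSubgroup.closure (gzSet ∪ (Set.range fun r : KZ.IntegralRep d => KZ.of r)), c - c' ∈ KZ.relations := by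
  intro c hc
  obtain ⟨c₀, hc₀, hcc₀⟩ := residual_iff.1 hRES c hc
  exact ⟨c₀, AddSubgroup.closure_mono Set.subset_union_left hc₀, hcc₀⟩

/-! ## §4 The bottom rung and the two dimension-one pieces of the split -/

/-- **The bottom rung from the dimension-one pieces.** `DimOneKernelInKZ` (every vanishing
`ℤ`-combination of one-dimensional representations is a relation) and `DimOneSeparation` (a
vanishing element of `closure (gzSet ∪ D₁)` is, modulo relations, a genus-zero combination plus a
VANISHING one-dimensional one) give the bottom rung: the vanishing one-dimensional part is a
relation. (Pieces stated over the named generator set `gzSet`; `gzSet_eq` is the read-back to the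
inlined set of `SPLIT.md`.) [folklore] -/
theorem bottom_of_kernel_of_separation
    (hK : ∀ h ∈ AddSubgroup.closure (Set.range fun r : KZ.IntegralRep 1 => KZ.of r), KZ.eval h = 0 → h ∈ KZ.relations)
    (hSep : ∀ m ∈ AddSubgroup.closure (gzSet ∪ (Set.range fun r : KZ.IntegralRep 1 => KZ.of r)), KZ.eval m = 0 →
      ∃ g ∈ AddSubgroup.closure gzSet, ∃ h ∈ AddSubgroup.closure (Set.range fun r : KZ.IntegralRep 1 => KZ.of r),
        KZ.eval h = 0 ∧ m - g - h ∈ KZ.relations) :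
    ∀ m ∈ AddSubgroup.closure (gzSet ∪ (Set.range fun r : KZ.IntegralRep 1 => KZ.of r)), KZ.eval m = 0 →
      ∃ g ∈ AddSubgroup.closure gzSet, m - g ∈ KZ.relations := by
  intro m hm hm0
  obtain ⟨g, hg, h, hh, hh0, hsep⟩ := hSep m hm hm0
  refine ⟨g, hg, ?_⟩
  have e : m - g = (m - g - h) + h := by abel
  rw [e]
  exact add_mem hsep (hK h hh hh0)

/-- **The bottom rung gives the separation piece outright** (take the vanishing one-dimensional
part to be `0`): so, granted `DimOneKernelInKZ`, `DimOneSeparation ↔ Bottom`, and unconditionally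
`Bottom → DimOneSeparation`. [folklore] -/
theorem dimOneSeparation_of_bottom
    (hB : ∀ m ∈ AddSubgroup.closure (gzSet ∪ (Set.range fun r : KZ.IntegralRep 1 => KZ.of r)), KZ.eval m = 0 →
      ∃ g ∈ AddSubgroup.closure gzSet, m - g ∈ KZ.relations) :
    ∀ m ∈ AddSubgroup.closure (gzSet ∪ (Set.range fun r : KZ.IntegralRep 1 => KZ.of r)), KZ.eval m = 0 →
      ∃ g ∈ AddSubgroup.closure gzSet, ∃ h ∈ AddSubgroup.closure (Set.range fun r : KZ.IntegralRep 1 => KZ.of r),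
        KZ.eval h = 0 ∧ m - g - h ∈ KZ.relations := by
  intro m hm hm0
  obtain ⟨g, hg, hmg⟩ := hB m hm hm0
  exact ⟨g, hg, 0, zero_mem _, map_zero _, by simpa using hmg⟩

/-- Granted the kernel piece, the separation piece and the bottom rung are equivalent. [folklore] -/
theorem dimOneSeparation_iff_bottom
    (hK : ∀ h ∈ AddSubgroup.closure (Set.range fun r : KZ.IntegralRep 1 => KZ.of r), KZ.eval h = 0 → h ∈ KZ.relations) :
    (∀ m ∈ AddSubgroup.closure (gzSet ∪ (Set.range fun r : KZ.IntegralRep 1 => KZ.of r)), KZ.eval m = 0 →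
      ∃ g ∈ AddSubgroup.closure gzSet, ∃ h ∈ AddSubgroup.closure (Set.range fun r : KZ.IntegralRep 1 => KZ.of r),
        KZ.eval h = 0 ∧ m - g - h ∈ KZ.relations) ↔
    ∀ m ∈ AddSubgroup.closure (gzSet ∪ (Set.range fun r : KZ.IntegralRep 1 => KZ.of r)), KZ.eval m = 0 →
      ∃ g ∈ AddSubgroup.closure gzSet, m - g ∈ KZ.relations :=
  ⟨bottom_of_kernel_of_separation hK, dimOneSeparation_of_bottom⟩

/-- **The line's composition with the declared stub unfolded into rungs**:
`DimOneKernelInKZ → DimOneSeparation → (∀ d ≥ 1, RelKer d) → ResidualBeyondGenusZero`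
(pieces over `gzSet`; the crux by name). This is `ResidualBeyondGenusZero_of` of
`Lines/dim_one_splice.lean` with `stub_residualBeyondDimOne` replaced by the rungs it is
equivalent to (`residualBeyondDimOne_iff_ladder`). [folklore] -/
theorem residualBeyondGenusZero_of_pieces_and_ladder
    (hK : ∀ h ∈ AddSubgroup.closure (Set.range fun r : KZ.IntegralRep 1 => KZ.of r), KZ.eval h = 0 → h ∈ KZ.relations)
    (hSep : ∀ m ∈ AddSubgroup.closure (gzSet ∪ (Set.range fun r : KZ.IntegralRep 1 => KZ.of r)), KZ.eval m = 0 →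
      ∃ g ∈ AddSubgroup.closure gzSet, ∃ h ∈ AddSubgroup.closure (Set.range fun r : KZ.IntegralRep 1 => KZ.of r),
        KZ.eval h = 0 ∧ m - g - h ∈ KZ.relations)
    (hL : ∀ d, 1 ≤ d → ∀ m ∈ AddSubgroup.closure (gzSet ∪ (Set.range fun r : KZ.IntegralRep (d + 1) => KZ.of r)), KZ.eval m = 0 →
      ∃ m' ∈ AddSubgroup.closure (gzSet ∪ (Set.range fun r : KZ.IntegralRep d => KZ.of r)), m - m' ∈ KZ.relations) :
    ResidualBeyondGenusZero :=
  residualBeyondGenusZero_iff_bottom_and_ladder.2 ⟨bottom_of_kernel_of_separation hK hSep, hL⟩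

/-- **Every rung and the bottom rung are kernel-implied**: under the kernel form of Conjecture 1
(`∀ c, eval c = 0 → c ∈ relations`, i.e. `KZKernelConjecture` unfolded) take `m' := 0`. Recorded so
that the planner sees each rung is at most summit-strength. [folklore] -/
theorem bottom_and_ladder_of_kernel (hKer : ∀ c : KZ.FormalRep, KZ.eval c = 0 → c ∈ KZ.relations) :
    (∀ m ∈ AddSubgroup.closure (gzSet ∪ (Set.range fun r : KZ.IntegralRep 1 => KZ.of r)), KZ.eval m = 0 →
        ∃ g ∈ AddSubgroup.closure gzSet, m - g ∈ KZ.relations) ∧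
      (∀ d, 1 ≤ d → ∀ m ∈ AddSubgroup.closure (gzSet ∪ (Set.range fun r : KZ.IntegralRep (d + 1) => KZ.of r)), KZ.eval m = 0 →
        ∃ m' ∈ AddSubgroup.closure (gzSet ∪ (Set.range fun r : KZ.IntegralRep d => KZ.of r)), m - m' ∈ KZ.relations) :=
  ⟨fun m _ hm0 => ⟨0, zero_mem _, by simpa using hKer m hm0⟩,
    fun _ _ m _ hm0 => ⟨0, zero_mem _, by simpa using hKer m hm0⟩⟩

end Summit.KontsevichZagierPeriods.ResidualBeyondGenusZero

end
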